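import Summits.BirchSwinnertonDyer.BirchSwinnertonDyer.Theorems.SchneiderFreeUpperSockets
import Literature.NumberTheory.EllipticCurves.IsogenyQuadraticTwistProofs
import Literature.NumberTheory.EllipticCurves.IsogenyIdProofs
import Literature.NumberTheory.EllipticCurves.ComplexMultiplicationLFunctionIsogenyHoldsProofs
import Literature.NumberTheory.EllipticCurves.KrizLi2019.SexticTwistBSDThreeDescent
import Literature.NumberTheory.EllipticCurves.BSDHeegnerPointsGrossZagierProofs
import Literature.NumberTheory.EllipticCurves.GrossZagierRationalPoint
import HarnessLib
import HarnessLib.Audit.Tags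

/-!
# Schneider-free additive X3 door — the UPPER sockets, part 2: the SPLIT twist-unit datum (Theses-free)

Cell `bsd-schneider-ideate`, seat `bsd-schneider-door-c5` (prover, generation 9); successor of
`Theorems/SchneiderFreeUpperSockets.lean` (§6 `TwistUnitHeegnerDataAt`, the BUNDLED datum). Statements are the
base unit's (planner P2 gen 13) kernel-checked Sketch `memos/ROUTE-P2-upper-v2-g13-Sketch.lean` §10
`section Split` VERBATIM (memo `memos/ROUTE-P2-upper-v2-g13.md` U29–U34), landed so that the wing's class-level
glue can be re-keyed to the WEAKER hypothesis (U34). Predicates + elementary readings only; nothing asserted;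
BSD is not advanced; the three printed facts of §2 enter as explicit hypotheses.

CENSUS-DRIVEN CORRECTION (memo §10, torsion supplement j264623 × member smoke j263377): the bundled datum
`TwistUnitHeegnerDataAt W₂ p` asks for a non-torsion Heegner point `P ∈ W₂(K)`, `W₂(K)[p] = 0` AND a `p`-unit
`#Ш_an(W₂^{d_K})` at ONE member `W₂`; in every class examined where `E` itself has no unit Heegner twist the
members WITH a unit twist are exactly the members WITH a rational `p`-torsion point, so the bundle is available at
NO member there. The glue (door-c5 gen 8, `…UpperWingGord` / `…UpperWingPotMult`) never used the point, the
torsion clause or the parametrisation datum of the unit member — only its FIELD and the unit. Hence: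

* §1 `TwistUnitFieldAt W p` — the SPLIT datum: an imaginary quadratic `K` with odd `d_K`, Heegner for `N_W`,
  `L(W^{d_K},1) ≠ 0`, and SOME `W₂ ∼ W` (any torsion) with a globally minimal model `W₂d` of `W₂^{d_K}` whose
  `#Ш_an` is a rational of non-positive `p`-adic valuation; `twistUnitFieldAt_of_twistUnitHeegnerDataAt` (the
  bundle at `W` gives it), `twistUnitFieldAt_of_isIsogenous_of_twistUnitHeegnerDataAt` (the bundle at any member
  of equal conductor gives it: `L(E^{d},1)` is an isogeny invariant, `entireLFunction_eq_of_isIsogenous'` with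
  `IsIsogenous.quadraticTwist`).
* §2 `exists_heegnerPoint_not_isOfFinAddOrder_of_twist_ne_zero` — for a GIVEN Heegner field with
  `L(W^{d_K},1) ≠ 0`, a curve of analytic rank one carries a non-torsion Heegner point over `K` (Heegner points
  over `K` + `L'(E/K,1) = L'(E,1)·L(E^{d_K},1)` + Gross–Zagier I.(6.3), all three as hypotheses): the POINT half
  of the bundled datum is a theorem at the co-chain member, which is why the split datum may drop it.

References: [GrossZagier1986] Thm. I.(6.3); [KrizLi2019] Thm. 1.20 and §9 (the class-wide shape of the unit);
[Vatsal1999] Thm. 0.3; [Knapp1993] Thm. 11.67 (isogenous curves have equal `L`-functions).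
-/

noncomputable section

open scoped Classical

open WeierstrassCurve NumberField IsDedekindDomain Field Literature.NumberTheory.EllipticCurves
  Literature.NumberTheory.EllipticCurves.ModularForms
  Literature.NumberTheory.EllipticCurves.GreenbergSelmer
  Literature.NumberTheory.EllipticCurves.Rank1Residual
  Literature.NumberTheory.EllipticCurves.Rank1Residual.Typed
  Summit.BirchSwinnertonDyer.Rank1Residual
  Summit.BirchSwinnertonDyer.Rank1Residual.X11b
  Summit.BirchSwinnertonDyer.Rank1Residual.X11b.AcSelmer
  Summit.BirchSwinnertonDyer.Rank1Residual.X11b.Halves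

set_option linter.dupNamespace false
set_option autoImplicit false

namespace Summit.BirchSwinnertonDyer.BirchSwinnertonDyer.Theorems.SchneiderFree.Upper

/-! ### §1 The SPLIT twist-unit datum (P2 gen 13 Sketch §10 VERBATIM) and its two bridges from the bundle -/

/-- **SPLIT twist-unit datum at `(W, p)` — a Heegner FIELD and a unit MEMBER, no point data, no torsion clause.**
A quadratic imaginary `K` with odd `d_K` satisfying the Heegner hypothesis for `N_W`, with `L(W^{d_K},1) ≠ 0`, and
SOME curve `W₂` of the `ℚ`-isogeny class of `W` with a globally minimal model `W₂d` of `W₂^{d_K}` whose `#Ш_an` is a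
rational of non-positive `p`-adic valuation. (`p ∤ d_K`, `p ∤ #𝓞_K^×` follow from `p ∣ N_W`, `p ≠ 2`; the Heegner
POINT at the co-chain member and `W₁(K)[p] = 0` there are theorems: `exists_isHeegnerPoint` + Gross–Zagier, and
door-c4 g7's `forall_baseChange_nsmul_eq_zero`.) Per pair a finite exact certificate; class-wide the statement
`TwistUnitX3Split` (memo U31, not declared here). A predicate; nothing asserted.
[cite: GrossZagier1986, Thm. I.(6.3)] [cite: KrizLi2019, Thm. 1.20] -/
@[conjecture]
def TwistUnitFieldAt (W : WeierstrassCurve ℚ) [W.IsElliptic] (p : ℕ) [Fact p.Prime] : Prop :=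
  ∃ (K : Type) (_ : Field K) (_ : NumberField K) (W₂ W₂d : WeierstrassCurve ℚ) (_ : W₂.IsElliptic)
    (_ : W₂.IsGloballyMinimal) (_ : W₂d.IsElliptic) (_ : W₂d.IsGloballyMinimal),
    IsImaginaryQuadratic K ∧ Odd (NumberField.discr K) ∧
    SatisfiesHeegnerHypothesis (W.conductorNorm ℤ) K ∧
    (W.quadraticTwist (NumberField.discr K : ℚ)).entireLFunction 1 ≠ 0 ∧
    IsIsogenous W W₂ ∧ (∃ C : VariableChange ℚ, C • W₂.quadraticTwist (NumberField.discr K : ℚ) = W₂d) ∧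
    ∃ qd : ℚ, shaAn W₂d = (qd : ℂ) ∧ padicValRat p qd ≤ 0

/-- The bundled datum at the curve itself gives the split datum (so the split class-wide statement is implied by
the bundled certificate wherever `E` itself carries it — the census's majority case). [folklore] -/
theorem twistUnitFieldAt_of_twistUnitHeegnerDataAt {W : WeierstrassCurve ℚ} [W.IsElliptic]
    [W.IsGloballyMinimal] {p : ℕ} [Fact p.Prime] (hT : TwistUnitHeegnerDataAt W p) :
    TwistUnitFieldAt W p := by
  obtain ⟨N, _, K, _, _, Dt, H, ι, P, Wd, _, _, hN, hK, hodd, -, hHH, hLd, -, -, -, hC, hunit⟩ := hT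
  exact ⟨K, inferInstance, inferInstance, W, Wd, inferInstance, inferInstance, inferInstance, inferInstance,
    hK, hodd, hN ▸ hHH, hLd, IsIsogenous.refl_holds W, hC, hunit⟩

/-- The bundled datum at ANY member gives the split datum at the presented curve (isogeny invariance of
`L(E^{d},1)`, unconditional in the tree: `entireLFunction_eq_of_isIsogenous'` with `IsIsogenous.quadraticTwist`;
conductor equality carried as a hypothesis — modularity or Ogg–Saito in the tree). [cite: Knapp1993, Thm. 11.67] -/
theorem twistUnitFieldAt_of_isIsogenous_of_twistUnitHeegnerDataAt {W W₂ : WeierstrassCurve ℚ} [W.IsElliptic]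
    [W₂.IsElliptic] [W₂.IsGloballyMinimal] {p : ℕ} [Fact p.Prime] (hiso : IsIsogenous W W₂)
    (hN : W₂.conductorNorm ℤ = W.conductorNorm ℤ) (hT : TwistUnitHeegnerDataAt W₂ p) :
    TwistUnitFieldAt W p := by
  obtain ⟨N, _, K, _, _, Dt, H, ι, P, Wd, _, _, hN2, hK, hodd, -, hHH, hLd, -, -, -, hC, hunit⟩ := hT
  have hD0 : (NumberField.discr K : ℚ) ≠ 0 := by exact_mod_cast NumberField.discr_ne_zero K
  haveI := W.isElliptic_quadraticTwist hD0
  haveI := W₂.isElliptic_quadraticTwist hD0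
  have hLd' : (W.quadraticTwist (NumberField.discr K : ℚ)).entireLFunction 1 ≠ 0 := by
    rw [entireLFunction_eq_of_isIsogenous' (hiso.quadraticTwist hD0)]; exact hLd
  refine ⟨K, inferInstance, inferInstance, W₂, Wd, inferInstance, inferInstance, inferInstance, inferInstance,
    hK, hodd, ?_, hLd', hiso, hC, hunit⟩
  rw [← hN, hN2]; exact hHH

/-! ### §2 The POINT half of the bundle is a theorem at a given Heegner field -/

/-- **For a GIVEN Heegner field with `L(W^{d_K},1) ≠ 0`, a curve of analytic rank one carries a non-torsion
Heegner point over `K`** (the door's `schneiderFreeAdditiveX3_heegnerTwistData_proof` minus the Friedberg–Hoffstein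
choice of the field): `exists_isHeegnerPoint` + `L'(E/K,1) = L'(E,1)·L(E^{d_K},1) ≠ 0` + Gross–Zagier I.(6.3),
the three facts as hypotheses. This is what makes the POINT half of the bundled datum a theorem at the co-chain
member. [cite: GrossZagier1986, Thm. I.(6.3)] -/
theorem exists_heegnerPoint_not_isOfFinAddOrder_of_twist_ne_zero
    (hHP : ∀ (W : WeierstrassCurve ℚ) (K : Type) [Field K] [NumberField K], exists_isHeegnerPoint W K)
    (hGZ : ∀ (N : ℕ) [NeZero N] (W : WeierstrassCurve ℚ) (K : Type) [Field K] [NumberField K],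
      gross_zagier N W K)
    (hmod : hasEntireLFunction_rat)
    (W : WeierstrassCurve ℚ) [W.IsElliptic] [W.IsGloballyMinimal] (N : ℕ) [NeZero N] (K : Type) [Field K]
    [NumberField K] (hr : W.analyticRank = 1) (hN : W.conductorNorm ℤ = N) (hK : IsImaginaryQuadratic K)
    (hHN : SatisfiesHeegnerHypothesis N K)
    (hLt : (W.quadraticTwist (NumberField.discr K : ℚ)).entireLFunction 1 ≠ 0) :
    ∃ (Dt : ModularParametrizationData W N) (H : HeegnerDatum N (NumberField.discr K)) (ι : K →+* ℂ)
      (P : (W.baseChange K).toAffine.Point),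
      WeierstrassCurve.Affine.Point.map ι.toRatAlgHom P = heegnerPointComplex Dt H ∧ ¬ IsOfFinAddOrder P := by
  subst hN
  obtain ⟨P, Dt, H, ι, hP⟩ := hHP W K hK hHN
  have hL0 : W.entireLFunction 1 = 0 := entireLFunction_one_eq_zero_of_analyticRank_eq_one hr
  obtain ⟨-, hderiv⟩ := leadingLCoeff_eq_deriv_of_analyticRank_eq_one hr
  have hprod := KrizLi2019.lDerivEK_eq_deriv_mul W K hmod hL0
  have hLK : LDerivEK W K ≠ 0 := by rw [hprod]; exact mul_ne_zero hderiv hLt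
  have hnt : ¬ IsOfFinAddOrder P :=
    (lDerivEK_ne_zero_iff_not_isOfFinAddOrder W (W.conductorNorm ℤ) K (hGZ _ W K) hK hHN
      ⟨Dt, H, ι, hP⟩).mp hLK
  exact ⟨Dt, H, ι, P, hP, hnt⟩

end Summit.BirchSwinnertonDyer.BirchSwinnertonDyer.Theorems.SchneiderFree.Upper

end
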